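import Mathlib.Analysis.SpecialFunctions.Pow.Real
import Mathlib.Analysis.SpecialFunctions.Exponential
import Mathlib.Analysis.Complex.ExponentialBounds
import Literature.NumberTheory.LFunctions.LargeValuesLongPolynomials
import HarnessLib

/-!
# Jutila 1977, large values of Dirichlet polynomials: reduction of the real parts `σ_r ≥ 0` to `σ = 0`

NOT RH-BEARING (D-0040; rh-crit cell C4, bears_on LADDER-RH §4 HELD row `DensityLadder`; F3 of the
Guth–Maynard corpus = the only external input of GM Proposition 12.1): a large-values theorem for
Dirichlet polynomials is RH-FREE literature; a density theorem counts zeros off the critical line, it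
never empties the strip (Barrier `Literature.Barriers.RiemannHypothesis.LindelofBacklund`); nothing in
this file is worded as, or is, progress toward RH.

Topic `Literature/NumberTheory/LFunctions`; namespace `Literature.NumberTheory.LFunctions.Jutila1977`.
THEOREMS only (no definition, no named fact, no `sorry`). Vocabulary: `jutilaG a N = ∑_{N<n≤2N} |a_n|²`
and the named fact `Jutila1977_theorem_1_4` of `LargeValuesLongPolynomials.lean` (M. Jutila,
*Zero-density estimates for L-functions*, Acta Arith. 32 (1977) 55–62, Theorem, estimate (1.4)).

## What is proved

Jutila states his Theorem for points `s_r = σ_r + it_r` with ARBITRARY real parts `σ_r ≥ 0`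
(p. 55), and opens the proof (p. 60) with "Also we may suppose that `0 ≤ σ_r ≤ 1/2`". This file
is that reduction, for the estimate (1.2) in the case `q = 1`
(`R ≪_{ε,k} (GNV⁻² + T(G⁴N²V⁻⁸)^k + (TG²V⁻⁴)^k) T^ε`), all the way down to real part `σ = 0`,
which is the form in which the tree's Guth–Maynard §§4–6 machinery (real ordinates `t ∈ W`)
proves the kernel estimate:

* `card_le_of_core`, `eq_1_2_q1_of_core` — **(1.2) with `q = 1` AS PRINTED (points `s_r ∈ ℂ`,
  `Re s_r ≥ 0`, `|Im s_r − Im s_s| ≤ T`, `1`-separated ordinates, `|∑_{N<n≤2N} a_n n^{-s_r}| ≥ V`)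
  follows from the same estimate at real part `0`** (the hypothesis `hcore`, "CORE₀" of the cell's
  F3 plan: finite `1`-separated `W ⊂ ℝ` of diameter `≤ T` with `|∑ a_n n^{-it}| ≥ V` on `W`), with
  the constant multiplied by `4 · 3^{8k}`.

The reduction (standard; Jutila gives no details): (a) STRIPS `j/2 ≤ Re s < (j+1)/2`: writing
`a_n n^{-s} = (a_n n^{-j/2}) n^{-(s − j/2)}`, the coefficients `a_n n^{-j/2}` have
`G_j ≤ (N+1)^{-j} G ≤ 2^{-j} G`, and each of the three printed terms is a power `≥ 1` of `G`, so strip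
`j` costs a factor `2^{-j}` — geometric, no bound on the number of strips is needed;
(b) inside a strip, `0 ≤ σ' = Re s − j/2 < 1/2` and `n^{-σ'} = N^{-σ'} ∑_i (−σ' log(n/N))^i / i!`,
so `|f(s)| ≤ ∑_i ((1/2)^i/i!) |f_i(it)|` with `f_i(it) = ∑ a_n n^{-j/2} log^i(n/N) n^{-it}`; since
`∑_i (1/2)^i (3/2)^i /(3 · i!) = e^{3/4}/3 < 1`, some `i` has `|f_i(it)| ≥ (3/2)^i V/3`
(`exists_taylor_index`), and the class `(j, i)` — coefficients `a_n n^{-j/2} log^i(n/N)` with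
`G_{j,i} ≤ 2^{-j} G` (`0 ≤ log(n/N) ≤ log 2 < 1`), level `(3/2)^i V/3` — is counted by the core at
cost `≤ 3^{8k} 2^{-j} (4/9)^i` times the printed bound (`rhs_class_le`); only finitely many classes
are inhabited and `∑_j 2^{-j} ∑_i (4/9)^i < 4`.

The passage from (1.2) to (1.4) (Huxley's subdivision, p. 60) is the cell's node O2
(`LargeValuesJutilaSubdivision.lean`, rh-crit-gm-t9); the kernel estimate CORE₀ is node K0.

WHAT THIS IS NOT: not the large-values theorem itself (its analytic kernel is a hypothesis here),
not a density theorem, not a route, not an RH residual.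

## References

* M. Jutila, *Zero-density estimates for L-functions*, Acta Arith. 32 (1977) 55–62: §1 p. 55
  (set-up), Theorem p. 56 ((1.2), (1.4)), §3 p. 60 ("we may suppose that `0 ≤ σ_r ≤ 1/2`");
  page images `gm/lit-jutila1977/page01–04.png` of the rh-crit cell. [Jutila1977]
-/

noncomputable section

open Real Complex Finset

namespace Literature.NumberTheory.LFunctions

namespace Jutila1977

/-! ## §0. Elementary facts about the Dirichlet polynomial `f(s) = ∑_{N<n≤2N} a_n n^{-s}` -/

/-- `|f(s)| ≤ ∑ |a_n|` for `Re s ≥ 0`, and `(∑_{N<n≤2N} |a_n|)² ≤ N · G`; hence `|f(s)|² ≤ N G`.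
[cite: Jutila1977, §1, p. 55 (set-up)] -/
theorem norm_sum_sq_le {N : ℕ} (a : ℕ → ℂ) {s : ℂ} (hs : 0 ≤ s.re) :
    ‖∑ n ∈ Finset.Ioc N (2 * N), a n * (n : ℂ) ^ (-s)‖ ^ 2 ≤ (N : ℝ) * jutilaG a N := by
  have h1 : ‖∑ n ∈ Finset.Ioc N (2 * N), a n * (n : ℂ) ^ (-s)‖ ≤
      ∑ n ∈ Finset.Ioc N (2 * N), ‖a n‖ := by
    refine (norm_sum_le _ _).trans (Finset.sum_le_sum fun n hn ↦ ?_)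
    rw [Finset.mem_Ioc] at hn
    have hn0 : 0 < n := by omega
    rw [norm_mul]
    refine mul_le_of_le_one_right (norm_nonneg _) ?_
    rw [Complex.norm_natCast_cpow_of_pos hn0, Complex.neg_re]
    exact Real.rpow_le_one_of_one_le_of_nonpos (by exact_mod_cast hn0) (by linarith)
  have h0 : 0 ≤ ‖∑ n ∈ Finset.Ioc N (2 * N), a n * (n : ℂ) ^ (-s)‖ := norm_nonneg _
  have hCS := Finset.sum_mul_sq_le_sq_mul_sq (Finset.Ioc N (2 * N)) (fun n ↦ ‖a n‖) (fun _ ↦ (1 : ℝ))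
  simp only [one_pow, mul_one, Finset.sum_const, Nat.card_Ioc, nsmul_eq_mul] at hCS
  rw [show 2 * N - N = N by omega] at hCS
  calc ‖∑ n ∈ Finset.Ioc N (2 * N), a n * (n : ℂ) ^ (-s)‖ ^ 2
      ≤ (∑ n ∈ Finset.Ioc N (2 * N), ‖a n‖) ^ 2 := pow_le_pow_left₀ h0 h1 2
    _ ≤ (∑ n ∈ Finset.Ioc N (2 * N), ‖a n‖ ^ 2) * N := by linarith
    _ = (N : ℝ) * jutilaG a N := by rw [jutilaG_def, mul_comm]

/-- If some point `s` with `Re s ≥ 0` has `|f(s)| ≥ V > 0` then `V² ≤ N G` and `G > 0`.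
[cite: Jutila1977, §1, p. 55 (set-up)] -/
theorem sq_le_of_le_norm {N : ℕ} (a : ℕ → ℂ) {s : ℂ} (hs : 0 ≤ s.re) {V : ℝ} (hV : 0 < V)
    (hle : V ≤ ‖∑ n ∈ Finset.Ioc N (2 * N), a n * (n : ℂ) ^ (-s)‖) :
    V ^ 2 ≤ (N : ℝ) * jutilaG a N ∧ 0 < jutilaG a N := by
  have h1 : V ^ 2 ≤ (N : ℝ) * jutilaG a N :=
    (pow_le_pow_left₀ hV.le hle 2).trans (norm_sum_sq_le a hs)
  refine ⟨h1, ?_⟩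
  rcases (jutilaG_nonneg a N).eq_or_lt with h | h
  · rw [← h, mul_zero] at h1
    nlinarith
  · exact h

/-! ## §1. Reduction of the real parts to `σ = 0`: strips and the Taylor expansion of `(n/N)^{-σ'}` -/

/-- The factorisation `n^{-s} = n^{-j/2} · N^{-σ'} · e^{-σ' log(n/N)} · n^{-it}` for
`s = σ + it`, `j = ⌊2σ⌋`, `σ' = σ − j/2` (`n, N ≥ 1`). [folklore] -/
private theorem cpow_neg_eq_factor {N n : ℕ} (hN : 1 ≤ N) (hn : 1 ≤ n) (s : ℂ) :
    (n : ℂ) ^ (-s) =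
      (((n : ℝ) ^ (-((⌊2 * s.re⌋₊ : ℝ) / 2)) : ℝ) : ℂ) *
        (((N : ℝ) ^ (-(s.re - ⌊2 * s.re⌋₊ / 2)) : ℝ) : ℂ) *
        Complex.exp ((-(s.re - ⌊2 * s.re⌋₊ / 2) * Real.log ((n : ℝ) / N) : ℝ) : ℂ) *
        (n : ℂ) ^ (-((s.im : ℂ) * I)) := by
  set j : ℕ := ⌊2 * s.re⌋₊ with hj
  set σ' : ℝ := s.re - j / 2 with hσ'
  have hn0 : (0 : ℝ) < n := by exact_mod_cast hn
  have hN0 : (0 : ℝ) < N := by exact_mod_cast hN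
  have hnC : (n : ℂ) ≠ 0 := by exact_mod_cast (by omega : n ≠ 0)
  -- split `-s = (-σ) + (-it)`
  have hs : -s = ((-s.re : ℝ) : ℂ) + -((s.im : ℂ) * I) := by
    apply Complex.ext <;> simp
  rw [hs, Complex.cpow_add _ _ hnC]
  congr 1
  -- the real power `n^{-σ}`
  rw [show ((n : ℕ) : ℂ) = ((n : ℝ) : ℂ) by norm_cast, ← Complex.ofReal_cpow hn0.le,
    ← Complex.ofReal_exp, ← Complex.ofReal_mul, ← Complex.ofReal_mul]
  congr 1
  have hsplit : (-s.re : ℝ) = -((j : ℝ) / 2) + (-σ') := by rw [hσ']; ring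
  rw [hsplit, Real.rpow_add hn0]
  have h2 : (n : ℝ) ^ (-σ') = (N : ℝ) ^ (-σ') * Real.exp (-σ' * Real.log ((n : ℝ) / N)) := by
    rw [Real.rpow_def_of_pos hn0, Real.rpow_def_of_pos hN0, ← Real.exp_add,
      Real.log_div hn0.ne' hN0.ne']
    ring_nf
  rw [h2, mul_assoc]

/-- **The Taylor step.** If `Re s ≥ 0` and `|∑_{N<n≤2N} a_n n^{-s}| ≥ V > 0`, then with
`j = ⌊2 Re s⌋`, `t = Im s`, for some `i ≥ 0` the Dirichlet polynomial with coefficients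
`a_n n^{-j/2} log^i(n/N)` is large at `it`: `|∑ a_n n^{-j/2} log^i(n/N) n^{-it}| ≥ (3/2)^i V/3`
(from `(n/N)^{-σ'} = ∑_i (−σ' log(n/N))^i/i!`, `0 ≤ σ' = Re s − j/2 < 1/2`, and
`∑_i (1/2)^i (3/2)^i /(3 · i!) = e^{3/4}/3 < 1`). [cite: Jutila1977, §3, p. 60 ("we may suppose
that 0 ≤ σ_r ≤ 1/2")] -/
theorem exists_taylor_index {N : ℕ} (hN : 1 ≤ N) (a : ℕ → ℂ) {V : ℝ} (hV : 0 < V) {s : ℂ}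
    (hs : 0 ≤ s.re) (hle : V ≤ ‖∑ n ∈ Finset.Ioc N (2 * N), a n * (n : ℂ) ^ (-s)‖) :
    ∃ i : ℕ, (3 / 2 : ℝ) ^ i * V / 3 ≤
      ‖∑ n ∈ Finset.Ioc N (2 * N),
        (a n * (((n : ℝ) ^ (-((⌊2 * s.re⌋₊ : ℝ) / 2)) : ℝ) : ℂ) *
          ((Real.log ((n : ℝ) / N) ^ i : ℝ) : ℂ)) * (n : ℂ) ^ (-((s.im : ℂ) * I))‖ := by
  set j : ℕ := ⌊2 * s.re⌋₊ with hj
  set σ' : ℝ := s.re - j / 2 with hσ'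
  have hN0 : (0 : ℝ) < N := by exact_mod_cast hN
  -- `0 ≤ σ' < 1/2`
  have hσ'0 : 0 ≤ σ' := by
    rw [hσ']
    have := Nat.floor_le (by linarith : 0 ≤ 2 * s.re)
    rw [← hj] at this; linarith
  have hσ'1 : σ' ≤ 1 / 2 := by
    rw [hσ']
    have := Nat.lt_floor_add_one (2 * s.re)
    rw [← hj] at this; linarith
  by_contra hcon
  push Not at hcon
  -- the Taylor series of every term
  set F : ℕ → ℂ := fun i ↦ ∑ n ∈ Finset.Ioc N (2 * N),
      (a n * (((n : ℝ) ^ (-((j : ℝ) / 2)) : ℝ) : ℂ) * ((Real.log ((n : ℝ) / N) ^ i : ℝ) : ℂ)) *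
        (n : ℂ) ^ (-((s.im : ℂ) * I)) with hF
  have hterm : ∀ n ∈ Finset.Ioc N (2 * N),
      HasSum (fun i : ℕ ↦ (((N : ℝ) ^ (-σ') : ℝ) : ℂ) * ((((-σ') ^ i / (Nat.factorial i : ℝ) : ℝ)) : ℂ) *
        ((a n * (((n : ℝ) ^ (-((j : ℝ) / 2)) : ℝ) : ℂ) * ((Real.log ((n : ℝ) / N) ^ i : ℝ) : ℂ)) *
          (n : ℂ) ^ (-((s.im : ℂ) * I))))
        (a n * (n : ℂ) ^ (-s)) := by
    intro n hn
    rw [Finset.mem_Ioc] at hn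
    have hn1 : 1 ≤ n := by omega
    have hexp : HasSum (fun i : ℕ ↦ (((-σ' * Real.log ((n : ℝ) / N) : ℝ) : ℂ)) ^ i /
        (Nat.factorial i : ℂ)) (Complex.exp ((-σ' * Real.log ((n : ℝ) / N) : ℝ) : ℂ)) := by
      rw [Complex.exp_eq_exp_ℂ]
      exact NormedSpace.expSeries_div_hasSum_exp _
    have h2 := (hexp.mul_left (a n * (((n : ℝ) ^ (-((j : ℝ) / 2)) : ℝ) : ℂ) *
      (((N : ℝ) ^ (-σ') : ℝ) : ℂ))).mul_right ((n : ℂ) ^ (-((s.im : ℂ) * I)))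
    have hfac := cpow_neg_eq_factor hN hn1 s
    rw [← hj] at hfac
    simp only [← hσ'] at hfac
    have hfun : (fun i : ℕ ↦ a n * (((n : ℝ) ^ (-((j : ℝ) / 2)) : ℝ) : ℂ) * (((N : ℝ) ^ (-σ') : ℝ) : ℂ) *
        ((((-σ' * Real.log ((n : ℝ) / N) : ℝ) : ℂ)) ^ i / (Nat.factorial i : ℂ)) *
        (n : ℂ) ^ (-((s.im : ℂ) * I))) =
        (fun i : ℕ ↦ (((N : ℝ) ^ (-σ') : ℝ) : ℂ) * ((((-σ') ^ i / (Nat.factorial i : ℝ) : ℝ)) : ℂ) *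
        ((a n * (((n : ℝ) ^ (-((j : ℝ) / 2)) : ℝ) : ℂ) * ((Real.log ((n : ℝ) / N) ^ i : ℝ) : ℂ)) *
          (n : ℂ) ^ (-((s.im : ℂ) * I)))) := by
      funext i
      push_cast
      ring
    have hval : a n * (((n : ℝ) ^ (-((j : ℝ) / 2)) : ℝ) : ℂ) * (((N : ℝ) ^ (-σ') : ℝ) : ℂ) *
        Complex.exp ((-σ' * Real.log ((n : ℝ) / N) : ℝ) : ℂ) * (n : ℂ) ^ (-((s.im : ℂ) * I)) =
        a n * (n : ℂ) ^ (-s) := by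
      rw [hfac]; ring
    rw [hfun, hval] at h2
    exact h2
  have hsum : HasSum (fun i : ℕ ↦ ∑ n ∈ Finset.Ioc N (2 * N),
      (((N : ℝ) ^ (-σ') : ℝ) : ℂ) * ((((-σ') ^ i / (Nat.factorial i : ℝ) : ℝ)) : ℂ) *
        ((a n * (((n : ℝ) ^ (-((j : ℝ) / 2)) : ℝ) : ℂ) * ((Real.log ((n : ℝ) / N) ^ i : ℝ) : ℂ)) *
          (n : ℂ) ^ (-((s.im : ℂ) * I))))
      (∑ n ∈ Finset.Ioc N (2 * N), a n * (n : ℂ) ^ (-s)) := hasSum_sum hterm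
  have hsum' : HasSum (fun i : ℕ ↦
      (((N : ℝ) ^ (-σ') : ℝ) : ℂ) * ((((-σ') ^ i / (Nat.factorial i : ℝ) : ℝ)) : ℂ) * F i)
      (∑ n ∈ Finset.Ioc N (2 * N), a n * (n : ℂ) ^ (-s)) := by
    convert hsum using 1
    funext i
    rw [hF]; dsimp only
    rw [Finset.mul_sum]
  -- the majorant `(V/3) (3/4)^i / i!`
  have hmaj : HasSum (fun i : ℕ ↦ V / 3 * ((3 / 4 : ℝ) ^ i / (Nat.factorial i : ℝ)))
      (V / 3 * Real.exp (3 / 4)) := by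
    rw [Real.exp_eq_exp_ℝ]
    exact (NormedSpace.expSeries_div_hasSum_exp (3 / 4 : ℝ)).mul_left (V / 3)
  have hbound : ∀ i : ℕ, ‖(((N : ℝ) ^ (-σ') : ℝ) : ℂ) *
      ((((-σ') ^ i / (Nat.factorial i : ℝ) : ℝ)) : ℂ) * F i‖ ≤
        V / 3 * ((3 / 4 : ℝ) ^ i / (Nat.factorial i : ℝ)) := by
    intro i
    have hfi : (0 : ℝ) < Nat.factorial i := by exact_mod_cast Nat.factorial_pos i
    have hNσ : ‖(((N : ℝ) ^ (-σ') : ℝ) : ℂ)‖ ≤ 1 := by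
      rw [Complex.norm_real, Real.norm_of_nonneg (Real.rpow_nonneg hN0.le _)]
      exact Real.rpow_le_one_of_one_le_of_nonpos (by exact_mod_cast hN) (by linarith)
    have hσi : ‖((((-σ') ^ i / (Nat.factorial i : ℝ) : ℝ)) : ℂ)‖ ≤ (1 / 2 : ℝ) ^ i / Nat.factorial i := by
      rw [Complex.norm_real, Real.norm_eq_abs, abs_div, abs_of_pos hfi, abs_pow, abs_neg,
        abs_of_nonneg hσ'0]
      gcongr
    have hFi : ‖F i‖ ≤ (3 / 2 : ℝ) ^ i * V / 3 := (hcon i).le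
    calc ‖(((N : ℝ) ^ (-σ') : ℝ) : ℂ) * ((((-σ') ^ i / (Nat.factorial i : ℝ) : ℝ)) : ℂ) * F i‖
        = ‖(((N : ℝ) ^ (-σ') : ℝ) : ℂ)‖ * ‖((((-σ') ^ i / (Nat.factorial i : ℝ) : ℝ)) : ℂ)‖ * ‖F i‖ := by
          rw [norm_mul, norm_mul]
      _ ≤ 1 * ((1 / 2 : ℝ) ^ i / Nat.factorial i) * ((3 / 2 : ℝ) ^ i * V / 3) := by
          gcongr
      _ = V / 3 * ((3 / 4 : ℝ) ^ i / (Nat.factorial i : ℝ)) := by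
          rw [show (3 / 4 : ℝ) ^ i = (1 / 2) ^ i * (3 / 2) ^ i by rw [← mul_pow]; norm_num]
          ring
  have hle2 := hsum'.norm_le_of_bounded hmaj hbound
  -- `e^{3/4} < 3`
  have hexp3 : Real.exp (3 / 4) < 3 := by
    have h1 : Real.exp (3 / 4) < Real.exp 1 := Real.exp_lt_exp.2 (by norm_num)
    have h2 := Real.exp_one_lt_d9
    linarith
  have : V / 3 * Real.exp (3 / 4) < V := by
    have := mul_lt_mul_of_pos_left hexp3 (by positivity : 0 < V / 3)
    linarith
  linarith


/-! ## §2. The classes `(j, i)` counted by the core estimate -/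

/-- The coefficient mean square of the class `(j,i)`: for the coefficients
`a_n n^{-j/2} log^i(n/N)` one has `G_{j,i} ≤ 2^{-j} G` (`n ≥ N+1 ≥ 2`, `0 ≤ log(n/N) ≤ log 2 < 1`).
[cite: Jutila1977, §3, p. 60] -/
theorem jutilaG_coef_le (a : ℕ → ℂ) {N : ℕ} (hN : 1 ≤ N) (j i : ℕ) :
    jutilaG (fun n ↦ a n * (((n : ℝ) ^ (-((j : ℝ) / 2)) : ℝ) : ℂ) *
        ((Real.log ((n : ℝ) / N) ^ i : ℝ) : ℂ)) N ≤ (2 : ℝ)⁻¹ ^ j * jutilaG a N := by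
  rw [jutilaG_def, jutilaG_def, Finset.mul_sum]
  refine Finset.sum_le_sum fun n hn ↦ ?_
  rw [Finset.mem_Ioc] at hn
  have hn2 : (2 : ℝ) ≤ n := by exact_mod_cast (by omega : 2 ≤ n)
  have hn0 : (0 : ℝ) < n := by linarith
  have hN0 : (0 : ℝ) < N := by exact_mod_cast hN
  have hnN1 : 1 ≤ (n : ℝ) / N := by
    rw [le_div_iff₀ hN0, one_mul]; exact_mod_cast (by omega : N ≤ n)
  have hnN2 : (n : ℝ) / N ≤ 2 := by
    rw [div_le_iff₀ hN0]; exact_mod_cast (by omega : n ≤ 2 * N)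
  have hL0 : 0 ≤ Real.log ((n : ℝ) / N) := Real.log_nonneg hnN1
  have hL1 : Real.log ((n : ℝ) / N) ≤ 1 := by
    have := Real.log_le_log (by positivity) hnN2
    have h2 := Real.log_two_lt_d9
    linarith
  -- the two real factors
  have hc1 : ‖(((n : ℝ) ^ (-((j : ℝ) / 2)) : ℝ) : ℂ)‖ ^ 2 ≤ (2 : ℝ)⁻¹ ^ j := by
    rw [Complex.norm_real, Real.norm_of_nonneg (Real.rpow_nonneg hn0.le _), ← Real.rpow_natCast,
      ← Real.rpow_mul hn0.le]
    have : -((j : ℝ) / 2) * ((2 : ℕ) : ℝ) = -(j : ℝ) := by push_cast; ring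
    rw [this, Real.rpow_neg hn0.le, Real.rpow_natCast, ← inv_pow]
    exact pow_le_pow_left₀ (by positivity) (by rw [inv_le_inv₀ hn0 (by norm_num)]; exact hn2) j
  have hc2 : ‖((Real.log ((n : ℝ) / N) ^ i : ℝ) : ℂ)‖ ^ 2 ≤ 1 := by
    rw [Complex.norm_real, Real.norm_of_nonneg (pow_nonneg hL0 _)]
    have : Real.log ((n : ℝ) / N) ^ i ≤ 1 := pow_le_one₀ hL0 hL1
    nlinarith [pow_nonneg hL0 i]
  calc ‖a n * (((n : ℝ) ^ (-((j : ℝ) / 2)) : ℝ) : ℂ) * ((Real.log ((n : ℝ) / N) ^ i : ℝ) : ℂ)‖ ^ 2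
      = ‖a n‖ ^ 2 * ‖(((n : ℝ) ^ (-((j : ℝ) / 2)) : ℝ) : ℂ)‖ ^ 2 *
          ‖((Real.log ((n : ℝ) / N) ^ i : ℝ) : ℂ)‖ ^ 2 := by
        rw [norm_mul, norm_mul]; ring
    _ ≤ ‖a n‖ ^ 2 * (2 : ℝ)⁻¹ ^ j * 1 := by gcongr
    _ = (2 : ℝ)⁻¹ ^ j * ‖a n‖ ^ 2 := by ring

/-- `x ^ (-m) = (x^m)⁻¹` for the literal exponents used below. [folklore] -/
private theorem rpow_neg_lit {x : ℝ} (hx : 0 ≤ x) (m : ℕ) : x ^ (-(m : ℝ)) = (x ^ m)⁻¹ := by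
  rw [Real.rpow_neg hx, Real.rpow_natCast]

/-- `y^m ≤ y` for `0 ≤ y ≤ 1`, `m ≥ 1`. [folklore] -/
private theorem pow_le_self_of_le_one' {y : ℝ} (h0 : 0 ≤ y) (h1 : y ≤ 1) {m : ℕ} (hm : 1 ≤ m) :
    y ^ m ≤ y :=
  pow_le_of_le_one h0 h1 (by omega)

/-- **Monotonicity of the right-hand side of (1.2)** (`q = 1`) in the class parameters: with
`G' ≤ 2^{-j} G` and `V' = (3/2)^i V / 3`,
`G'NV'^{-2} + T(G'^4N²V'^{-8})^k + (TG'²V'^{-4})^k ≤ 3^{8k} 2^{-j} (4/9)^i (GNV^{-2} + T(G⁴N²V^{-8})^k + (TG²V^{-4})^k)`.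
[cite: Jutila1977, §3, p. 60] -/
theorem rhs_class_le {k : ℕ} (hk : 1 ≤ k) {G G' N T V : ℝ} (hG' : 0 ≤ G') (hN : 0 ≤ N)
    (hT : 0 ≤ T) (hV : 0 < V) (j i : ℕ) (hGG : G' ≤ (2 : ℝ)⁻¹ ^ j * G) :
    G' * N * ((3 / 2 : ℝ) ^ i * V / 3) ^ (-2 : ℝ) +
        T * (G' ^ 4 * N ^ 2 * ((3 / 2 : ℝ) ^ i * V / 3) ^ (-8 : ℝ)) ^ k +
        (T * G' ^ 2 * ((3 / 2 : ℝ) ^ i * V / 3) ^ (-4 : ℝ)) ^ k ≤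
      3 ^ (8 * k) * (2 : ℝ)⁻¹ ^ j * (4 / 9 : ℝ) ^ i *
        (G * N * V ^ (-2 : ℝ) + T * (G ^ 4 * N ^ 2 * V ^ (-8 : ℝ)) ^ k +
          (T * G ^ 2 * V ^ (-4 : ℝ)) ^ k) := by
  have hG : 0 ≤ G := by
    have : 0 < (2 : ℝ)⁻¹ ^ j := by positivity
    nlinarith
  set q : ℝ := (3 / 2 : ℝ) ^ i with hq
  have hq0 : 0 < q := by positivity
  set V' : ℝ := q * V / 3 with hV'
  have hV'0 : 0 < V' := by positivity
  set p : ℝ := q⁻¹ with hp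
  have hp0 : 0 < p := by positivity
  have hr : (4 / 9 : ℝ) ^ i = p ^ 2 := by
    rw [hp, hq, ← inv_pow, ← pow_mul, mul_comm, pow_mul]; norm_num
  set y : ℝ := (2 : ℝ)⁻¹ ^ j * (4 / 9 : ℝ) ^ i with hy
  have hy0 : 0 ≤ y := by positivity
  have hy1 : y ≤ 1 := by
    rw [hy]
    exact mul_le_one₀ (pow_le_one₀ (by norm_num) (by norm_num)) (by positivity)
      (pow_le_one₀ (by norm_num) (by norm_num))
  -- rewrite the negative powers
  have e2 : ∀ {x : ℝ}, 0 ≤ x → x ^ (-2 : ℝ) = (x ^ 2)⁻¹ := fun hx ↦ by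
    rw [show (-2 : ℝ) = -((2 : ℕ) : ℝ) by norm_num]; exact rpow_neg_lit hx 2
  have e4 : ∀ {x : ℝ}, 0 ≤ x → x ^ (-4 : ℝ) = (x ^ 4)⁻¹ := fun hx ↦ by
    rw [show (-4 : ℝ) = -((4 : ℕ) : ℝ) by norm_num]; exact rpow_neg_lit hx 4
  have e8 : ∀ {x : ℝ}, 0 ≤ x → x ^ (-8 : ℝ) = (x ^ 8)⁻¹ := fun hx ↦ by
    rw [show (-8 : ℝ) = -((8 : ℕ) : ℝ) by norm_num]; exact rpow_neg_lit hx 8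
  rw [e2 hV'0.le, e4 hV'0.le, e8 hV'0.le, e2 hV.le, e4 hV.le, e8 hV.le]
  -- `V'^{-m} = 3^m p^m V^{-m}`
  have hinv : ∀ m : ℕ, (V' ^ m)⁻¹ = 3 ^ m * p ^ m * (V ^ m)⁻¹ := by
    intro m
    rw [hV', hp, div_pow, mul_pow, inv_pow]
    field_simp
  rw [hinv 2, hinv 4, hinv 8]
  -- the three terms
  have h3k : (9 : ℝ) ≤ 3 ^ (8 * k) := by
    calc (9 : ℝ) = 3 ^ 2 := by norm_num
      _ ≤ 3 ^ (8 * k) := pow_le_pow_right₀ (by norm_num) (by omega)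
  have h81k : (81 : ℝ) ^ k ≤ 3 ^ (8 * k) := by
    rw [pow_mul]; exact pow_le_pow_left₀ (by norm_num) (by norm_num) k
  set X₁ : ℝ := G * N * (V ^ 2)⁻¹ with hX₁
  set X₂ : ℝ := T * (G ^ 4 * N ^ 2 * (V ^ 8)⁻¹) ^ k with hX₂
  set X₃ : ℝ := (T * G ^ 2 * (V ^ 4)⁻¹) ^ k with hX₃
  have hX₁0 : 0 ≤ X₁ := by positivity
  have hX₂0 : 0 ≤ X₂ := by positivity
  have hX₃0 : 0 ≤ X₃ := by positivity
  -- term 1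
  have hT1 : G' * N * (3 ^ 2 * p ^ 2 * (V ^ 2)⁻¹) ≤ 3 ^ (8 * k) * y * X₁ := by
    calc G' * N * (3 ^ 2 * p ^ 2 * (V ^ 2)⁻¹)
        ≤ ((2 : ℝ)⁻¹ ^ j * G) * N * (3 ^ 2 * p ^ 2 * (V ^ 2)⁻¹) := by gcongr
      _ = 9 * y * X₁ := by rw [hy, hr, hX₁]; ring
      _ ≤ 3 ^ (8 * k) * y * X₁ := by gcongr
  -- term 2
  have hT2 : T * (G' ^ 4 * N ^ 2 * (3 ^ 8 * p ^ 8 * (V ^ 8)⁻¹)) ^ k ≤ 3 ^ (8 * k) * y * X₂ := by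
    have hin : G' ^ 4 * N ^ 2 * (3 ^ 8 * p ^ 8 * (V ^ 8)⁻¹) ≤
        (3 ^ 8 * y ^ 4) * (G ^ 4 * N ^ 2 * (V ^ 8)⁻¹) := by
      have h4 : G' ^ 4 ≤ ((2 : ℝ)⁻¹ ^ j * G) ^ 4 := pow_le_pow_left₀ hG' hGG 4
      have hp8 : p ^ 8 = ((4 / 9 : ℝ) ^ i) ^ 4 := by rw [hr]; ring
      calc G' ^ 4 * N ^ 2 * (3 ^ 8 * p ^ 8 * (V ^ 8)⁻¹)
          ≤ ((2 : ℝ)⁻¹ ^ j * G) ^ 4 * N ^ 2 * (3 ^ 8 * p ^ 8 * (V ^ 8)⁻¹) := by gcongr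
        _ = (3 ^ 8 * y ^ 4) * (G ^ 4 * N ^ 2 * (V ^ 8)⁻¹) := by rw [hy, hp8]; ring
    have hyk : (3 ^ 8 * y ^ 4) ^ k ≤ 3 ^ (8 * k) * y := by
      rw [mul_pow, ← pow_mul]
      refine mul_le_mul_of_nonneg_left ?_ (by positivity)
      calc (y ^ 4) ^ k ≤ y ^ 4 := pow_le_self_of_le_one' (by positivity) (pow_le_one₀ hy0 hy1) hk
        _ ≤ y := pow_le_self_of_le_one' hy0 hy1 (by norm_num)
    calc T * (G' ^ 4 * N ^ 2 * (3 ^ 8 * p ^ 8 * (V ^ 8)⁻¹)) ^ k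
        ≤ T * ((3 ^ 8 * y ^ 4) * (G ^ 4 * N ^ 2 * (V ^ 8)⁻¹)) ^ k := by gcongr
      _ = (3 ^ 8 * y ^ 4) ^ k * X₂ := by rw [hX₂, mul_pow]; ring
      _ ≤ 3 ^ (8 * k) * y * X₂ := mul_le_mul_of_nonneg_right hyk hX₂0
  -- term 3
  have hT3 : (T * G' ^ 2 * (3 ^ 4 * p ^ 4 * (V ^ 4)⁻¹)) ^ k ≤ 3 ^ (8 * k) * y * X₃ := by
    have hin : T * G' ^ 2 * (3 ^ 4 * p ^ 4 * (V ^ 4)⁻¹) ≤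
        (81 * y ^ 2) * (T * G ^ 2 * (V ^ 4)⁻¹) := by
      have h2 : G' ^ 2 ≤ ((2 : ℝ)⁻¹ ^ j * G) ^ 2 := pow_le_pow_left₀ hG' hGG 2
      have hp4 : p ^ 4 = ((4 / 9 : ℝ) ^ i) ^ 2 := by rw [hr]; ring
      calc T * G' ^ 2 * (3 ^ 4 * p ^ 4 * (V ^ 4)⁻¹)
          ≤ T * ((2 : ℝ)⁻¹ ^ j * G) ^ 2 * (3 ^ 4 * p ^ 4 * (V ^ 4)⁻¹) := by gcongr
        _ = (81 * y ^ 2) * (T * G ^ 2 * (V ^ 4)⁻¹) := by rw [hy, hp4]; ring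
    have hyk : (81 * y ^ 2) ^ k ≤ 3 ^ (8 * k) * y := by
      rw [mul_pow]
      refine mul_le_mul h81k ?_ (by positivity) (by positivity)
      calc (y ^ 2) ^ k ≤ y ^ 2 := pow_le_self_of_le_one' (by positivity) (pow_le_one₀ hy0 hy1) hk
        _ ≤ y := pow_le_self_of_le_one' hy0 hy1 (by norm_num)
    calc (T * G' ^ 2 * (3 ^ 4 * p ^ 4 * (V ^ 4)⁻¹)) ^ k
        ≤ ((81 * y ^ 2) * (T * G ^ 2 * (V ^ 4)⁻¹)) ^ k :=
          pow_le_pow_left₀ (by positivity) hin k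
      _ = (81 * y ^ 2) ^ k * X₃ := by rw [hX₃, mul_pow]
      _ ≤ 3 ^ (8 * k) * y * X₃ := mul_le_mul_of_nonneg_right hyk hX₃0
  have hsum := add_le_add (add_le_add hT1 hT2) hT3
  calc _ ≤ 3 ^ (8 * k) * y * X₁ + 3 ^ (8 * k) * y * X₂ + 3 ^ (8 * k) * y * X₃ := hsum
    _ = 3 ^ (8 * k) * (2 : ℝ)⁻¹ ^ j * (4 / 9 : ℝ) ^ i * (X₁ + X₂ + X₃) := by rw [hy]; ring

/-- Partial geometric sums: `∑_{i<n} x^i ≤ 1/(1−x)` for `0 ≤ x < 1`. [folklore] -/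
private theorem geom_sum_le_inv {x : ℝ} (h0 : 0 ≤ x) (h1 : x < 1) (n : ℕ) :
    ∑ i ∈ Finset.range n, x ^ i ≤ 1 / (1 - x) := by
  rw [geom_sum_eq h1.ne n, le_div_iff₀ (by linarith)]
  have hx : 0 ≤ x ^ n := pow_nonneg h0 n
  have : (x ^ n - 1) / (x - 1) * (1 - x) = 1 - x ^ n := by
    field_simp [(by linarith : x - 1 ≠ 0)]
    ring
  linarith [this]

/-! ## §3. Estimate (1.2) with `q = 1` for points with arbitrary real parts `σ_r ≥ 0`, from the core -/

/-- **Jutila's (1.2) with `q = 1`, real parts `σ_r ≥ 0` as printed, from the core estimate at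
`σ = 0`.** If for every `k ≥ 1`, `ε > 0` there is `C` such that every finite `1`-separated set
`W ⊂ ℝ` of diameter `≤ T` (`T ≥ 2`) on which `|∑_{N<n≤2N} a_n n^{-it}| ≥ V > 0` has
`#W ≤ C T^ε (GNV⁻² + T(G⁴N²V⁻⁸)^k + (TG²V⁻⁴)^k)` (the CORE: estimate (1.2), `q = 1`, at real part
`0`), then the same bound, with another constant, holds for finite sets of points
`s_r = σ_r + it_r` with `σ_r ≥ 0`, `|t_r − t_s| ≤ T`, `|t_r − t_s| ≥ 1` (`r ≠ s`) and
`|∑ a_n n^{-s_r}| ≥ V`: split by `j = ⌊2σ_r⌋` (coefficients `a_n n^{-j/2}`, `G_j ≤ 2^{-j}G`) and by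
the Taylor index `i` of `exists_taylor_index` (coefficients `a_n n^{-j/2} log^i(n/N)`, level
`(3/2)^i V/3`); each class is counted by the core and the classes sum to `≤ 4 · 3^{8k}` times the
bound (`rhs_class_le`, geometric in `j` and `i`). This is the reduction "we may suppose that
`0 ≤ σ_r ≤ 1/2`" of p. 60. [cite: Jutila1977, Theorem (1.2) (case q = 1) and §3, p. 60] -/
theorem card_le_of_core
    (hcore : ∀ k : ℕ, 1 ≤ k → ∀ ε : ℝ, 0 < ε → ∃ C : ℝ,
      ∀ (N : ℕ) (T V : ℝ) (a : ℕ → ℂ) (W : Finset ℝ),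
      1 ≤ N → 2 ≤ T → 0 < V →
      (∀ t ∈ W, ∀ t' ∈ W, |t - t'| ≤ T) →
      (∀ t ∈ W, ∀ t' ∈ W, t ≠ t' → 1 ≤ |t - t'|) →
      (∀ t ∈ W, V ≤ ‖∑ n ∈ Finset.Ioc N (2 * N), a n * (n : ℂ) ^ (-((t : ℂ) * I))‖) →
      (W.card : ℝ) ≤ C * T ^ ε * (jutilaG a N * N * V ^ (-2 : ℝ) +
        T * (jutilaG a N ^ 4 * (N : ℝ) ^ 2 * V ^ (-8 : ℝ)) ^ k +
        (T * jutilaG a N ^ 2 * V ^ (-4 : ℝ)) ^ k))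
    {k : ℕ} (hk : 1 ≤ k) {ε : ℝ} (hε : 0 < ε) :
    ∃ C : ℝ, 0 ≤ C ∧ ∀ (N : ℕ) (T V : ℝ) (a : ℕ → ℂ) (S : Finset ℂ),
      1 ≤ N → 2 ≤ T → 0 < V →
      (∀ s ∈ S, 0 ≤ s.re) → (∀ s ∈ S, ∀ s' ∈ S, |s.im - s'.im| ≤ T) →
      (∀ s ∈ S, ∀ s' ∈ S, s ≠ s' → 1 ≤ |s.im - s'.im|) →
      (∀ s ∈ S, V ≤ ‖∑ n ∈ Finset.Ioc N (2 * N), a n * (n : ℂ) ^ (-s)‖) →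
      (S.card : ℝ) ≤ C * T ^ ε * (jutilaG a N * N * V ^ (-2 : ℝ) +
        T * (jutilaG a N ^ 4 * (N : ℝ) ^ 2 * V ^ (-8 : ℝ)) ^ k +
        (T * jutilaG a N ^ 2 * V ^ (-4 : ℝ)) ^ k) := by
  obtain ⟨C, hC⟩ := hcore k hk ε hε
  refine ⟨4 * 3 ^ (8 * k) * max C 0, by positivity,
    fun N T V a S hN hT hV hre hdiam hsep hlarge ↦ ?_⟩
  classical
  have hT0 : 0 < T := by linarith
  have hN0 : (0 : ℝ) < N := by exact_mod_cast hN
  -- the coefficients of the class `(j, i)` and the level `V_i`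
  set cf : ℕ → ℕ → ℕ → ℂ := fun j i n ↦
    a n * (((n : ℝ) ^ (-((j : ℝ) / 2)) : ℝ) : ℂ) * ((Real.log ((n : ℝ) / N) ^ i : ℝ) : ℂ) with hcf
  set Vl : ℕ → ℝ := fun i ↦ (3 / 2 : ℝ) ^ i * V / 3 with hVl
  have hVl0 : ∀ i, 0 < Vl i := fun i ↦ by rw [hVl]; positivity
  -- every point has a Taylor index
  have hex : ∀ s ∈ S, ∃ i : ℕ, Vl i ≤
      ‖∑ n ∈ Finset.Ioc N (2 * N), cf ⌊2 * s.re⌋₊ i n * (n : ℂ) ^ (-((s.im : ℂ) * I))‖ :=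
    fun s hs ↦ exists_taylor_index hN a hV (hre s hs) (hlarge s hs)
  choose! ι hι using hex
  -- the classes
  set cls : ℕ → ℕ → Finset ℂ := fun j i ↦ S.filter (fun s ↦ ⌊2 * s.re⌋₊ = j ∧
    Vl i ≤ ‖∑ n ∈ Finset.Ioc N (2 * N), cf j i n * (n : ℂ) ^ (-((s.im : ℂ) * I))‖) with hcls
  set J : ℕ := S.sup (fun s ↦ ⌊2 * s.re⌋₊) + 1 with hJ
  set I₀ : ℕ := S.sup ι + 1 with hI₀
  have hcover : S ⊆ (Finset.range J).biUnion
      (fun j ↦ (Finset.range I₀).biUnion (fun i ↦ cls j i)) := by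
    intro s hs
    simp only [Finset.mem_biUnion, Finset.mem_range]
    refine ⟨⌊2 * s.re⌋₊, ?_, ι s, ?_, ?_⟩
    · rw [hJ, Nat.lt_add_one_iff]
      exact Finset.le_sup (f := fun s ↦ ⌊2 * s.re⌋₊) hs
    · rw [hI₀, Nat.lt_add_one_iff]
      exact Finset.le_sup (f := ι) hs
    · rw [hcls, Finset.mem_filter]
      exact ⟨hs, rfl, hι s hs⟩
  -- the right-hand side
  set X : ℝ := jutilaG a N * N * V ^ (-2 : ℝ) + T * (jutilaG a N ^ 4 * (N : ℝ) ^ 2 * V ^ (-8 : ℝ)) ^ k +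
    (T * jutilaG a N ^ 2 * V ^ (-4 : ℝ)) ^ k with hX
  have hX0 : 0 ≤ X := by
    rw [hX]
    have := jutilaG_nonneg a N
    positivity
  -- one class
  have hclass : ∀ j i : ℕ, ((cls j i).card : ℝ) ≤
      max C 0 * T ^ ε * (3 ^ (8 * k) * (2 : ℝ)⁻¹ ^ j * (4 / 9 : ℝ) ^ i * X) := by
    intro j i
    set W : Finset ℝ := (cls j i).image Complex.im with hW
    have hsub : cls j i ⊆ S := Finset.filter_subset _ _
    have hinj : Set.InjOn Complex.im (cls j i : Set ℂ) := by
      intro s hs s' hs' h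
      by_contra hne
      have h1 := hsep s (hsub hs) s' (hsub hs') hne
      rw [h, sub_self, abs_zero] at h1
      linarith
    have hcardW : W.card = (cls j i).card := Finset.card_image_of_injOn hinj
    have hmemW : ∀ t ∈ W, ∃ s ∈ cls j i, s.im = t := fun t ht ↦ by
      rw [hW, Finset.mem_image] at ht; exact ht
    have hdiamW : ∀ t ∈ W, ∀ t' ∈ W, |t - t'| ≤ T := by
      intro t ht t' ht'
      obtain ⟨s, hs, rfl⟩ := hmemW t ht
      obtain ⟨s', hs', rfl⟩ := hmemW t' ht'
      exact hdiam s (hsub hs) s' (hsub hs')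
    have hsepW : ∀ t ∈ W, ∀ t' ∈ W, t ≠ t' → 1 ≤ |t - t'| := by
      intro t ht t' ht' hne
      obtain ⟨s, hs, rfl⟩ := hmemW t ht
      obtain ⟨s', hs', rfl⟩ := hmemW t' ht'
      exact hsep s (hsub hs) s' (hsub hs') (fun h ↦ hne (by rw [h]))
    have hlargeW : ∀ t ∈ W, Vl i ≤
        ‖∑ n ∈ Finset.Ioc N (2 * N), cf j i n * (n : ℂ) ^ (-((t : ℂ) * I))‖ := by
      intro t ht
      obtain ⟨s, hs, rfl⟩ := hmemW t ht
      rw [hcls, Finset.mem_filter] at hs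
      exact hs.2.2
    have hcore' := hC N T (Vl i) (cf j i) W hN hT (hVl0 i) hdiamW hsepW hlargeW
    have hG' := jutilaG_coef_le a hN j i
    have hmono := rhs_class_le hk (G' := jutilaG (cf j i) N) (jutilaG_nonneg _ _) hN0.le hT0.le hV j i hG'
    have hTε : 0 ≤ T ^ ε := Real.rpow_nonneg hT0.le _
    rw [← hcardW]
    calc (W.card : ℝ) ≤ C * T ^ ε * (jutilaG (cf j i) N * N * Vl i ^ (-2 : ℝ) +
          T * (jutilaG (cf j i) N ^ 4 * (N : ℝ) ^ 2 * Vl i ^ (-8 : ℝ)) ^ k +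
          (T * jutilaG (cf j i) N ^ 2 * Vl i ^ (-4 : ℝ)) ^ k) := hcore'
      _ ≤ max C 0 * T ^ ε * (jutilaG (cf j i) N * N * Vl i ^ (-2 : ℝ) +
          T * (jutilaG (cf j i) N ^ 4 * (N : ℝ) ^ 2 * Vl i ^ (-8 : ℝ)) ^ k +
          (T * jutilaG (cf j i) N ^ 2 * Vl i ^ (-4 : ℝ)) ^ k) := by
          have h0 : 0 ≤ jutilaG (cf j i) N * N * Vl i ^ (-2 : ℝ) +
              T * (jutilaG (cf j i) N ^ 4 * (N : ℝ) ^ 2 * Vl i ^ (-8 : ℝ)) ^ k +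
              (T * jutilaG (cf j i) N ^ 2 * Vl i ^ (-4 : ℝ)) ^ k := by
            have := jutilaG_nonneg (cf j i) N
            have := (hVl0 i).le
            positivity
          gcongr
          exact le_max_left _ _
      _ ≤ max C 0 * T ^ ε * (3 ^ (8 * k) * (2 : ℝ)⁻¹ ^ j * (4 / 9 : ℝ) ^ i * X) := by
          rw [hX]
          exact mul_le_mul_of_nonneg_left hmono (by positivity)
  -- geometric sums
  have hgeomJ : ∑ j ∈ Finset.range J, (2 : ℝ)⁻¹ ^ j ≤ 2 := by
    have := geom_sum_le_inv (x := (2 : ℝ)⁻¹) (by norm_num) (by norm_num) J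
    norm_num at this ⊢
    exact this
  have hgeomI : ∑ i ∈ Finset.range I₀, (4 / 9 : ℝ) ^ i ≤ 2 := by
    have := geom_sum_le_inv (x := (4 / 9 : ℝ)) (by norm_num) (by norm_num) I₀
    norm_num at this ⊢
    linarith
  -- summation over the classes
  have hMC : 0 ≤ max C 0 * T ^ ε := by positivity
  calc (S.card : ℝ)
      ≤ (((Finset.range J).biUnion (fun j ↦ (Finset.range I₀).biUnion (fun i ↦ cls j i))).card : ℝ) := by
        exact_mod_cast Finset.card_le_card hcover
    _ ≤ ∑ j ∈ Finset.range J, (((Finset.range I₀).biUnion (fun i ↦ cls j i)).card : ℝ) := by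
        exact_mod_cast Finset.card_biUnion_le
    _ ≤ ∑ j ∈ Finset.range J, ∑ i ∈ Finset.range I₀, ((cls j i).card : ℝ) := by
        refine Finset.sum_le_sum fun j _ ↦ ?_
        exact_mod_cast Finset.card_biUnion_le
    _ ≤ ∑ j ∈ Finset.range J, ∑ i ∈ Finset.range I₀,
          max C 0 * T ^ ε * (3 ^ (8 * k) * (2 : ℝ)⁻¹ ^ j * (4 / 9 : ℝ) ^ i * X) :=
        Finset.sum_le_sum fun j _ ↦ Finset.sum_le_sum fun i _ ↦ hclass j i
    _ = max C 0 * T ^ ε * 3 ^ (8 * k) * X *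
          ((∑ j ∈ Finset.range J, (2 : ℝ)⁻¹ ^ j) * (∑ i ∈ Finset.range I₀, (4 / 9 : ℝ) ^ i)) := by
        rw [Finset.sum_mul_sum]
        rw [Finset.mul_sum]
        refine Finset.sum_congr rfl fun j _ ↦ ?_
        rw [Finset.mul_sum]
        refine Finset.sum_congr rfl fun i _ ↦ ?_
        ring
    _ ≤ max C 0 * T ^ ε * 3 ^ (8 * k) * X * (2 * 2) := by
        have h0 : 0 ≤ max C 0 * T ^ ε * 3 ^ (8 * k) * X := by positivity
        refine mul_le_mul_of_nonneg_left ?_ h0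
        exact mul_le_mul hgeomJ hgeomI (Finset.sum_nonneg fun i _ ↦ by positivity) (by norm_num)
    _ = 4 * 3 ^ (8 * k) * max C 0 * T ^ ε * X := by ring

/-- **Estimate (1.2), `q = 1`, AS PRINTED, from the core at real part `0`** — `card_le_of_core` in
the binder shape of the cell's interface text EQ12Q1 (the hypothesis of
`Jutila1977.theorem_1_4_of_theorem_1_2`, node O2): for every `k ≥ 1`, `ε > 0` there is `C` with
`#S ≤ C (GNV⁻² + T(G⁴N²V⁻⁸)^k + (TG²V⁻⁴)^k) T^ε` for all data as in Jutila's Theorem (case (iii),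
`χ = χ₀ mod 1`, i.e. (1.2) with `q = 1`). [cite: Jutila1977, Theorem (1.2) (case q = 1), p. 56, and §3, p. 60] -/
theorem eq_1_2_q1_of_core
    (hcore : ∀ k : ℕ, 1 ≤ k → ∀ ε : ℝ, 0 < ε → ∃ C : ℝ,
      ∀ (N : ℕ) (T V : ℝ) (a : ℕ → ℂ) (W : Finset ℝ),
      1 ≤ N → 2 ≤ T → 0 < V →
      (∀ t ∈ W, ∀ t' ∈ W, |t - t'| ≤ T) →
      (∀ t ∈ W, ∀ t' ∈ W, t ≠ t' → 1 ≤ |t - t'|) →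
      (∀ t ∈ W, V ≤ ‖∑ n ∈ Finset.Ioc N (2 * N), a n * (n : ℂ) ^ (-((t : ℂ) * I))‖) →
      (W.card : ℝ) ≤ C * T ^ ε * (jutilaG a N * N * V ^ (-2 : ℝ) +
        T * (jutilaG a N ^ 4 * (N : ℝ) ^ 2 * V ^ (-8 : ℝ)) ^ k +
        (T * jutilaG a N ^ 2 * V ^ (-4 : ℝ)) ^ k)) :
    ∀ k : ℕ, 1 ≤ k → ∀ ε : ℝ, 0 < ε → ∃ C : ℝ,
      ∀ (N : ℕ) (T V : ℝ) (a : ℕ → ℂ) (S : Finset ℂ),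
      1 ≤ N → 2 ≤ T → 0 < V →
      (∀ s ∈ S, 0 ≤ s.re) → (∀ s ∈ S, ∀ s' ∈ S, |s.im - s'.im| ≤ T) →
      (∀ s ∈ S, ∀ s' ∈ S, s ≠ s' → 1 ≤ |s.im - s'.im|) →
      (∀ s ∈ S, V ≤ ‖∑ n ∈ Finset.Ioc N (2 * N), a n * (n : ℂ) ^ (-s)‖) →
      (S.card : ℝ) ≤ C * (jutilaG a N * N * V ^ (-2 : ℝ) +
        T * (jutilaG a N ^ 4 * (N : ℝ) ^ 2 * V ^ (-8 : ℝ)) ^ k +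
        (T * jutilaG a N ^ 2 * V ^ (-4 : ℝ)) ^ k) * T ^ ε := by
  intro k hk ε hε
  obtain ⟨C, -, hC⟩ := card_le_of_core hcore hk hε
  refine ⟨C, fun N T V a S hN hT hV hre hdiam hsep hlarge ↦ ?_⟩
  calc (S.card : ℝ) ≤ C * T ^ ε * (jutilaG a N * N * V ^ (-2 : ℝ) +
        T * (jutilaG a N ^ 4 * (N : ℝ) ^ 2 * V ^ (-8 : ℝ)) ^ k +
        (T * jutilaG a N ^ 2 * V ^ (-4 : ℝ)) ^ k) := hC N T V a S hN hT hV hre hdiam hsep hlarge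
    _ = _ := by ring
end Jutila1977

end Literature.NumberTheory.LFunctions
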